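import Summits.QuantumAdvantage.QuantumAdvantage.Theorems.SosSandwichPseudoBoundedAASymmetricCornerSharp
import Literature.Computability.Complexity.DyadicAutocorrelation
import HarnessLib

/-!
# Crux `PseudoBoundedAA` (stmt-QuantumAdvantage-15237) / `AAConj` (10748) — the BLOCK-SYMMETRIC CORNER, part 1/2:
# block restrictions of a polynomial and Efron–Stein over blocks in the Walsh basis

Toolkit for `Theorems/SosSandwichPseudoBoundedAABlockSymmetricCorner.lean` (part 2/2), which proves the Aaronson–Ambainis
conjecture on the block-symmetric corner (`∃ i, Var[p]²/(64 d² m²) ≤ Inf_i[p]` for `[0,1]`-bounded `p` of degree `≤ d`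
symmetric inside each of `m` blocks; item (3) of the g6 repair census of the crux, "block-symmetric corner via an
Efron–Stein block decomposition").

§1 THE BLOCK RESTRICTION AS A POLYNOMIAL.  For a block `B ⊆ [N]` (enumerated by `B.equivFin : B ≃ Fin |B|`), an OUTSIDE
point `y ∈ {0,1}^N` and a BLOCK point `z ∈ {0,1}^{|B|}`, the GLUED point is `i ↦ z(k)` if `i` is the `k`-th element of
`B` and `i ↦ y_i` otherwise, and the BLOCK RESTRICTION `p|_{B,y}` is `bind₁ (i ↦ X_k if i ∈ B is its k-th element,
else C y_i) p`, a polynomial in `|B|` variables; both are written INLINE (no definitions).  It has total degree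
`≤ deg p` (`totalDegree_blockRestrict_le`), evaluates on the cube as `p` at the glued point (`evalBool_blockRestrict`),
block flips commute with gluing (`flipBit_glue`), and `(y, z) ↦ glued point` is `2^{|B|}`-to-one (`sum_sum_glue`, via
the involution `(y, z) ↦ (glue, y|_B)` of `{0,1}^N × {0,1}^{|B|}`).
§2 AVERAGES.  `E_x H(x|_B) = E_z H(z)` (`boolAvg_comp_restr`); the influence of a block variable on `p` is the
`y`-average of its influence on `p|_{B,y}` (`influence_eq_boolAvg_blockRestrict`); `Var[p|_{B,y}]` is the variance of
the fibre function `x ↦ p(Bᶜ.piecewise y x)` (`boolVariance_blockRestrict`).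
§3 EFRON–STEIN OVER BLOCKS.  `E(g − Eg)² = Σ_{T ≠ ∅} ĝ(T)²` (`fvar_eq_sum_sq_fourier`); the block term
`E_y Var_x[g(Bᶜ.piecewise y x)] = Σ_{S ∩ B ≠ ∅} ĝ(S)²` (`condVar_eq_sum_sq_fourier`, from O'Donnell Cor. 3.22 = tree
`avg_sq_cubeFourierCoeff_piecewise`); for a block map `blk : [N] → [m]` the block terms of `blk⁻¹(j)` sum to at least
the variance (`fvar_le_sum_condVar`: every non-empty `S` meets a block), so some block term is `≥ Var/m`
(`exists_condVar_ge`).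

Elementary cube bookkeeping over the tree's Fourier–Walsh toolkit; no named facts.
[cite: ODonnell2014, Prop. 3.21, Cor. 3.22, §1.4, §2.2] [cite: AaronsonAmbainis2014, Thm. 3.3 (proof: restrictions)]
-/

-- D-0017: single-conjunct summit ⇒ the duplicate `QuantumAdvantage.QuantumAdvantage` is mandated.
set_option linter.dupNamespace false

noncomputable section

open Finset MvPolynomial
open Literature.Computability.QuantumComplexity
open Literature.Computability.Complexity.LowDegree Literature.Probability.RandomGraphs.LowDegree
open Summit.QuantumAdvantage.QuantumAdvantage.Cruxes.DecoupledCoreAA.L1Family.Poincare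
  (boolVariance_eq_sq_sub four_mul_sq_sub_le_sum_influence)

namespace Summit.QuantumAdvantage.QuantumAdvantage.Theorems.SosSandwich.BlockSymmetricCorner

variable {N : ℕ}

/-! ### §1 Restricting a polynomial to a block of variables

For a block `B ⊆ [N]` (enumerated by `B.equivFin : B ≃ Fin |B|`), an OUTSIDE point `y ∈ {0,1}^N` and a BLOCK point
`z ∈ {0,1}^{|B|}`, the GLUED point is `i ↦ z(k)` if `i` is the `k`-th element of `B` and `i ↦ y_i` otherwise; the
BLOCK RESTRICTION `p|_{B,y}` is `bind₁ (i ↦ X_k if i ∈ B is its k-th element, else C y_i) p`, a polynomial in `|B|`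
variables.  Both are written inline throughout. -/

/-- Substituting polynomials of total degree `≤ 1` does not raise the total degree (folklore; private copy of the
tree's `totalDegree_bind₁_le_of_le_one`). [folklore] -/
private theorem totalDegree_bind₁_le_of_forall_le_one {σ τ : Type*} (φ : σ → MvPolynomial τ ℝ)
    (hφ : ∀ i, (φ i).totalDegree ≤ 1) (F : MvPolynomial σ ℝ) :
    (bind₁ φ F).totalDegree ≤ F.totalDegree := by
  classical
  conv_lhs => rw [F.as_sum]
  rw [map_sum]
  refine (totalDegree_finsetSum _ _).trans (Finset.sup_le fun e he => ?_)
  rw [bind₁_monomial]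
  refine (totalDegree_mul _ _).trans ?_
  rw [totalDegree_C, zero_add]
  refine (totalDegree_finsetProd _ _).trans ?_
  refine le_trans (Finset.sum_le_sum fun i _ => (totalDegree_pow _ _).trans
    (Nat.mul_le_mul_left _ (hφ i))) ?_
  simp only [mul_one]
  exact le_totalDegree he

/-- The block restriction does not raise the total degree. [folklore] -/
theorem totalDegree_blockRestrict_le (B : Finset (Fin N)) (y : Fin N → Bool) (p : MvPolynomial (Fin N) ℝ) :
    (bind₁ (fun i => if h : i ∈ B then X (B.equivFin ⟨i, h⟩) else C (if y i then (1 : ℝ) else 0)) p).totalDegree ≤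
      p.totalDegree := by
  refine totalDegree_bind₁_le_of_forall_le_one _ (fun i => ?_) p
  by_cases h : i ∈ B
  · rw [dif_pos h, totalDegree_X]
  · rw [dif_neg h, totalDegree_C]; exact Nat.zero_le _

/-- On the cube, the block restriction evaluates as `p` at the glued point. [folklore] -/
theorem evalBool_blockRestrict (B : Finset (Fin N)) (y : Fin N → Bool) (p : MvPolynomial (Fin N) ℝ)
    (z : Fin B.card → Bool) :
    evalBool (bind₁ (fun i => if h : i ∈ B then X (B.equivFin ⟨i, h⟩) else C (if y i then (1 : ℝ) else 0)) p) z =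
      evalBool p (fun i => if h : i ∈ B then z (B.equivFin ⟨i, h⟩) else y i) := by
  have hfun : (fun i : Fin N => MvPolynomial.eval (fun k : Fin B.card => if z k then (1 : ℝ) else 0)
      (if h : i ∈ B then X (B.equivFin ⟨i, h⟩) else C (if y i then (1 : ℝ) else 0))) =
      fun i => if (if h : i ∈ B then z (B.equivFin ⟨i, h⟩) else y i) then (1 : ℝ) else 0 := by
    funext i
    by_cases h : i ∈ B
    · rw [dif_pos h, dif_pos h, eval_X]
    · rw [dif_neg h, dif_neg h, eval_C]
  unfold evalBool
  rw [← hfun]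
  exact eval₂Hom_bind₁ (RingHom.id ℝ) _ _ p

/-- The values of the block restriction, as a function on `{0,1}^{|B|}`. [folklore] -/
theorem evalBool_blockRestrict_eq (B : Finset (Fin N)) (y : Fin N → Bool) (p : MvPolynomial (Fin N) ℝ) :
    evalBool (bind₁ (fun i => if h : i ∈ B then X (B.equivFin ⟨i, h⟩) else C (if y i then (1 : ℝ) else 0)) p) =
      fun z => evalBool p (fun i => if h : i ∈ B then z (B.equivFin ⟨i, h⟩) else y i) :=
  funext (evalBool_blockRestrict B y p)

/-- Reading the glued point on the block returns the block point. [folklore] -/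
theorem restr_glue (B : Finset (Fin N)) (y : Fin N → Bool) (z : Fin B.card → Bool) :
    (fun k => (fun i => if h : i ∈ B then z (B.equivFin ⟨i, h⟩) else y i) (B.equivFin.symm k).1) = z := by
  funext k
  simp only [dif_pos (B.equivFin.symm k).2]
  simp

/-- Gluing the glued point (outside) with the outside point's own block part gives the outside point back.
[folklore] -/
theorem glue_glue_restr (B : Finset (Fin N)) (y : Fin N → Bool) (z : Fin B.card → Bool) :
    (fun i' => if h : i' ∈ B then (fun k => y (B.equivFin.symm k).1) (B.equivFin ⟨i', h⟩) else (fun i => if h : i ∈ B then z (B.equivFin ⟨i, h⟩) else y i) i') = y := by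
  funext i'
  by_cases h : i' ∈ B
  · simp only [dif_pos h]
    simp
  · simp only [dif_neg h]

/-- The glued point of `y` with the block part of `x` is the override `Bᶜ.piecewise y x`. [folklore] -/
theorem glue_restr (B : Finset (Fin N)) (y x : Fin N → Bool) :
    (fun i => if h : i ∈ B then (fun k => x (B.equivFin.symm k).1) (B.equivFin ⟨i, h⟩) else y i) = Bᶜ.piecewise y x := by
  funext i
  by_cases h : i ∈ B
  · simp only [dif_pos h, Finset.piecewise_eq_of_notMem _ _ _ (show i ∉ Bᶜ by simpa using h)]
    simp
  · simp only [dif_neg h, Finset.piecewise_eq_of_mem _ _ _ (show i ∈ Bᶜ by simpa using h)]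

/-- Flipping a block variable of the glued point = gluing with the flipped block point. [folklore] -/
theorem flipBit_glue (B : Finset (Fin N)) (y : Fin N → Bool) (z : Fin B.card → Bool) {i : Fin N} (hi : i ∈ B) :
    flipBit i (fun i' => if h : i' ∈ B then z (B.equivFin ⟨i', h⟩) else y i') =
      (fun i' => if h : i' ∈ B then (flipBit (B.equivFin ⟨i, hi⟩) z) (B.equivFin ⟨i', h⟩) else y i') := by
  funext i'
  unfold flipBit
  by_cases hii : i' = i
  · subst hii
    rw [Function.update_self]
    dsimp only
    rw [dif_pos hi, dif_pos hi, Function.update_self]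
  · rw [Function.update_of_ne hii]
    by_cases h' : i' ∈ B
    · rw [dif_pos h', dif_pos h']
      have hne : B.equivFin ⟨i', h'⟩ ≠ B.equivFin ⟨i, hi⟩ := by
        intro heq
        have := B.equivFin.injective heq
        exact hii (by simpa using this)
      rw [Function.update_of_ne hne]
    · rw [dif_neg h', dif_neg h']

/-- **Counting lemma**: summing `F` of the glued point over all outside points `y ∈ {0,1}^N` and block points
`z ∈ {0,1}^{|B|}` counts every cube point exactly `2^{|B|}` times (the map `(y, z) ↦ (glue, y|_B)` is an involution of
`{0,1}^N × {0,1}^{|B|}`). [folklore] -/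
theorem sum_sum_glue (B : Finset (Fin N)) (F : (Fin N → Bool) → ℝ) :
    ∑ y : Fin N → Bool, ∑ z : Fin B.card → Bool, F (fun i => if h : i ∈ B then z (B.equivFin ⟨i, h⟩) else y i) =
      2 ^ B.card * ∑ x : Fin N → Bool, F x := by
  have hinv : Function.Involutive fun q : (Fin N → Bool) × (Fin B.card → Bool) =>
      ((fun i => if h : i ∈ B then q.2 (B.equivFin ⟨i, h⟩) else q.1 i), fun k => q.1 (B.equivFin.symm k).1) := by
    rintro ⟨y, z⟩
    simp only [glue_glue_restr, restr_glue]
  rw [← Fintype.sum_prod_type']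
  rw [Fintype.sum_equiv hinv.toPerm
    (fun q : (Fin N → Bool) × (Fin B.card → Bool) => F fun i => if h : i ∈ B then q.2 (B.equivFin ⟨i, h⟩) else q.1 i)
    (fun q => F q.1) fun q => rfl]
  rw [Fintype.sum_prod_type]
  simp only [sum_const, card_univ, Fintype.card_fun, Fintype.card_bool, Fintype.card_fin, nsmul_eq_mul, mul_sum]
  push_cast
  rfl

/-! ### §2 Averages over a block: influences and the variance of the block restriction -/

/-- A cube average of a block reading is the block average: `E_{x ∈ {0,1}^N} H(x|_B) = E_{z ∈ {0,1}^{|B|}} H(z)`.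
[folklore] -/
theorem boolAvg_comp_restr (B : Finset (Fin N)) (H : (Fin B.card → Bool) → ℝ) :
    boolAvg (fun x : Fin N → Bool => H (fun k => x (B.equivFin.symm k).1)) = boolAvg H := by
  have h := sum_sum_glue B (fun x => H (fun k => x (B.equivFin.symm k).1))
  simp only [restr_glue, sum_const, card_univ, Fintype.card_fun, Fintype.card_bool, Fintype.card_fin,
    nsmul_eq_mul] at h
  push_cast at h
  unfold boolAvg
  have h2N : (2 : ℝ) ^ N ≠ 0 := by positivity
  have h2n : (2 : ℝ) ^ B.card ≠ 0 := by positivity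
  rw [div_eq_div_iff h2N h2n]
  linarith [h]

/-- **Influence = average of conditional influences**: for a block variable `i ∈ B` (the `k`-th element of `B`),
`Inf_i[p] = E_y Inf_k[p|_{B,y}]`. [cite: ODonnell2014, §2.2–§2.3] -/
theorem influence_eq_boolAvg_blockRestrict (B : Finset (Fin N)) (p : MvPolynomial (Fin N) ℝ) {i : Fin N}
    (hi : i ∈ B) :
    influence i p = boolAvg fun y => influence (B.equivFin ⟨i, hi⟩)
      (bind₁ (fun i => if h : i ∈ B then X (B.equivFin ⟨i, h⟩) else C (if y i then (1 : ℝ) else 0)) p) := by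
  have h := sum_sum_glue B (fun x => (evalBool p x - evalBool p (flipBit i x)) ^ 2)
  beta_reduce at h
  unfold influence boolAvg
  simp_rw [evalBool_blockRestrict, ← flipBit_glue B _ _ hi]
  rw [← Finset.sum_div, h, mul_div_cancel_left₀ _ (by positivity)]

/-- **Variance of the block restriction = fibre variance of the override**:
`Var[p|_{B,y}] = Var_x[p(y|_{Bᶜ} ∪ x|_B)]`. [cite: ODonnell2014, §3.3] -/
theorem boolVariance_blockRestrict (B : Finset (Fin N)) (y : Fin N → Bool) (p : MvPolynomial (Fin N) ℝ) :
    boolVariance (bind₁ (fun i => if h : i ∈ B then X (B.equivFin ⟨i, h⟩) else C (if y i then (1 : ℝ) else 0)) p) =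
      boolAvg (fun x => (evalBool p (Bᶜ.piecewise y x) - boolAvg (fun x => evalBool p (Bᶜ.piecewise y x))) ^ 2) := by
  unfold boolVariance
  simp_rw [← glue_restr B y, evalBool_blockRestrict_eq]
  rw [boolAvg_comp_restr B (fun z => evalBool p (fun i => if h : i ∈ B then z (B.equivFin ⟨i, h⟩) else y i))]
  exact (boolAvg_comp_restr B (fun z => (evalBool p (fun i => if h : i ∈ B then z (B.equivFin ⟨i, h⟩) else y i) -
    boolAvg (fun z => evalBool p (fun i => if h : i ∈ B then z (B.equivFin ⟨i, h⟩) else y i))) ^ 2)).symm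

/-! ### §3 Efron–Stein over blocks, in the Walsh basis

The variance of a cube function `g` is `E (g − E g)²`; the BLOCK TERM of `B` is the `y`-average of the variance of the
fibre function `x ↦ g(Bᶜ.piecewise y x)`; both inline. -/

/-- Coefficients of a shifted function: `(g − c)^(T) = ĝ(T) − c·[T = ∅]`. [cite: ODonnell2014, §1.2] -/
theorem cubeFourierCoeff_sub_const (g : (Fin N → Bool) → ℝ) (c : ℝ) (T : Finset (Fin N)) :
    cubeFourierCoeff (fun x => g x - c) T = cubeFourierCoeff g T - if T = ∅ then c else 0 := by
  unfold cubeFourierCoeff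
  have hχ : ∑ x : Fin N → Bool, walsh T x = if T = ∅ then (2 : ℝ) ^ N else 0 := by
    have h := sum_walsh_mul_walsh_index T ∅
    simpa only [walsh_empty, mul_one] using h
  simp_rw [sub_mul, Finset.sum_sub_distrib]
  rw [sub_div, ← Finset.mul_sum, hχ]
  have h2N : (2 : ℝ) ^ N ≠ 0 := by positivity
  split_ifs
  · rw [mul_div_assoc, div_self h2N, mul_one]
  · rw [mul_zero, zero_div]

/-- **Variance in the Walsh basis**: `E (g − E g)² = Σ_{T ≠ ∅} ĝ(T)²`. [cite: ODonnell2014, §1.4 (Parseval)] -/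
theorem fvar_eq_sum_sq_fourier (g : (Fin N → Bool) → ℝ) :
    boolAvg (fun x => (g x - boolAvg (fun x => g x)) ^ 2) =
      ∑ T ∈ univ.filter (fun T : Finset (Fin N) => T ≠ ∅), cubeFourierCoeff g T ^ 2 := by
  have hP := sum_cubeFourierCoeff_sq (fun x => g x - boolAvg (fun x => g x))
  rw [show boolAvg (fun x => (g x - boolAvg (fun x => g x)) ^ 2) =
      (∑ x, (g x - boolAvg (fun x => g x)) ^ 2) / 2 ^ N from rfl, ← hP,
    ← Finset.sum_filter_add_sum_filter_not univ (fun T : Finset (Fin N) => T ≠ ∅)]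
  have h0 : ∑ T ∈ univ.filter (fun T : Finset (Fin N) => ¬ T ≠ ∅),
      cubeFourierCoeff (fun x => g x - boolAvg (fun x => g x)) T ^ 2 = 0 := by
    refine Finset.sum_eq_zero fun T hT => ?_
    have hT' : T = ∅ := by simpa using hT
    subst hT'
    rw [cubeFourierCoeff_sub_const, if_pos rfl, cubeFourierCoeff_empty]
    unfold boolAvg
    ring
  rw [h0, add_zero]
  refine Finset.sum_congr rfl fun T hT => ?_
  have hT' : T ≠ ∅ := by simpa using hT
  rw [cubeFourierCoeff_sub_const, if_neg hT', sub_zero]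

/-- **The block term in the Walsh basis**: `E_y Var_x[g(Bᶜ.piecewise y x)] = Σ_{S ∩ B ≠ ∅} ĝ(S)²` (O'Donnell
Cor. 3.22 summed over `T ≠ ∅`). [cite: ODonnell2014, Cor. 3.22] -/
theorem condVar_eq_sum_sq_fourier (B : Finset (Fin N)) (g : (Fin N → Bool) → ℝ) :
    boolAvg (fun y => boolAvg (fun x => (g (Bᶜ.piecewise y x) - boolAvg (fun x => g (Bᶜ.piecewise y x))) ^ 2)) =
      ∑ S : Finset (Fin N), if S.filter (· ∈ B) ≠ ∅ then cubeFourierCoeff g S ^ 2 else 0 := by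
  simp_rw [fvar_eq_sum_sq_fourier (fun x => g (Bᶜ.piecewise _ x))]
  unfold boolAvg
  rw [Finset.sum_comm, Finset.sum_div]
  simp_rw [avg_sq_cubeFourierCoeff_piecewise g Bᶜ]
  rw [Finset.sum_comm]
  refine Finset.sum_congr rfl fun S _ => ?_
  rw [Finset.sum_ite_eq]
  have hfilt : S.filter (· ∉ Bᶜ) = S.filter (· ∈ B) :=
    Finset.filter_congr fun i _ => by rw [Finset.mem_compl, not_not]
  simp only [Finset.mem_filter, Finset.mem_univ, true_and, hfilt]

/-- **Efron–Stein over blocks**: for a block map `blk : [N] → [m]`, `Var[g] ≤ Σ_j (block term of blk⁻¹(j))` — every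
non-empty `S` meets some block. [cite: ODonnell2014, §3.3] -/
theorem fvar_le_sum_condVar {m : ℕ} (blk : Fin N → Fin m) (g : (Fin N → Bool) → ℝ) :
    boolAvg (fun x => (g x - boolAvg (fun x => g x)) ^ 2) ≤
      ∑ j : Fin m, boolAvg (fun y => boolAvg (fun x => (g ((univ.filter fun i => blk i = j)ᶜ.piecewise y x) - boolAvg (fun x => g ((univ.filter fun i => blk i = j)ᶜ.piecewise y x))) ^ 2)) := by
  rw [fvar_eq_sum_sq_fourier, Finset.sum_filter]
  simp_rw [condVar_eq_sum_sq_fourier]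
  rw [Finset.sum_comm]
  refine Finset.sum_le_sum fun S _ => ?_
  have hnn : ∀ j : Fin m, 0 ≤ (if S.filter (· ∈ univ.filter fun i => blk i = j) ≠ ∅ then
      cubeFourierCoeff g S ^ 2 else 0) := fun j => by
    split_ifs
    · exact sq_nonneg _
    · exact le_rfl
  split_ifs with hS
  · obtain ⟨i, hi⟩ := Finset.nonempty_iff_ne_empty.mpr hS
    have hmem : S.filter (· ∈ univ.filter fun i' => blk i' = blk i) ≠ ∅ :=
      Finset.ne_empty_of_mem (Finset.mem_filter.2 ⟨hi, Finset.mem_filter.2 ⟨Finset.mem_univ _, rfl⟩⟩)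
    calc cubeFourierCoeff g S ^ 2
        = (if S.filter (· ∈ univ.filter fun i' => blk i' = blk i) ≠ ∅ then cubeFourierCoeff g S ^ 2 else 0) := by
          rw [if_pos hmem]
      _ ≤ ∑ j : Fin m, (if S.filter (· ∈ univ.filter fun i' => blk i' = j) ≠ ∅ then
            cubeFourierCoeff g S ^ 2 else 0) :=
          Finset.single_le_sum (fun j _ => hnn j) (Finset.mem_univ (blk i))
  · exact Finset.sum_nonneg fun j _ => hnn j

/-- **Some block carries a block term `≥ Var/m`.** [cite: ODonnell2014, §3.3] -/
theorem exists_condVar_ge {m : ℕ} (hm : 0 < m) (blk : Fin N → Fin m) (g : (Fin N → Bool) → ℝ) :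
    ∃ j : Fin m, boolAvg (fun x => (g x - boolAvg (fun x => g x)) ^ 2) / m ≤
      boolAvg (fun y => boolAvg (fun x => (g ((univ.filter fun i => blk i = j)ᶜ.piecewise y x) - boolAvg (fun x => g ((univ.filter fun i => blk i = j)ᶜ.piecewise y x))) ^ 2)) := by
  have hne : (Finset.univ : Finset (Fin m)).Nonempty := Finset.univ_nonempty_iff.mpr ⟨⟨0, hm⟩⟩
  have hle : ∑ _j : Fin m, boolAvg (fun x => (g x - boolAvg (fun x => g x)) ^ 2) / m ≤
      ∑ j : Fin m, boolAvg (fun y => boolAvg (fun x => (g ((univ.filter fun i => blk i = j)ᶜ.piecewise y x) - boolAvg (fun x => g ((univ.filter fun i => blk i = j)ᶜ.piecewise y x))) ^ 2)) := by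
    rw [Finset.sum_const, Finset.card_univ, Fintype.card_fin, nsmul_eq_mul]
    have hm0 : (m : ℝ) ≠ 0 := by exact_mod_cast hm.ne'
    rw [mul_div_cancel₀ _ hm0]
    exact fvar_le_sum_condVar blk g
  obtain ⟨j, -, hj⟩ := Finset.exists_le_of_sum_le hne hle
  exact ⟨j, hj⟩

end Summit.QuantumAdvantage.QuantumAdvantage.Theorems.SosSandwich.BlockSymmetricCorner

end
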